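import Summits.CriticalPhenomena.Ising3DConformalLimit.Theorems.PrecisionLaplacianMoebiusLimitOfTwoPointLawDyadicReduction
import Summits.CriticalPhenomena.Ising3DConformalLimit.Theorems.PrecisionLaplacianMoebiusLimitOfTwoPointLawOfMoebiusLimitExists
import Summits.CriticalPhenomena.Ising3DConformalLimit.Theorems.PrecisionLaplacianMoebiusLimitOfTwoPointLawBareExistence
import Summits.CriticalPhenomena.Ising3DConformalLimit.Theorems.MoebiusLimitOfTwoPointLaw.Negative.CanonicalForm
import Summits.CriticalPhenomena.Ising3DConformalLimit.Theses.WeylWindow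
import HarnessLib

/-!
# Where the two stubs of line `SketchIdeator5R2` sit among the items (crux `MoebiusLimitOfTwoPointLaw`,
# item stmt-CriticalPhenomena-4801; `--supports stmt-CriticalPhenomena-4801`)

The line's skeleton is `MoebiusLimitOfTwoPointLaw_of : D₂ → I₂ → crux` over the landed glue
`moebiusLimitOfTwoPointLaw_of_dyadic` (`…DyadicReduction.lean`). This file records, by name, how the two
stubs compare with EXISTING items, so that the planner can read the dependency graph off the tree:

* `dyadicCanonicalLimit_of_limitExists` — under a witness `(Δ, c)` of the two-point law, bare
  existence `WeylWindow.LimitExists` (item stmt-CriticalPhenomena-4738: SOME `ρ > 0`, full filter,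
  all arities, `S₂ > 0`) already gives the canonically renormalised DYADIC limits of every arity:
  `ρ(δ) ~ κ δ^{-Δ}` is forced (`tendsto_canonical_ratio`, crux disprover, `Negative/CanonicalForm.lean`),
  renormalisations with convergent ratio are interchangeable
  (`hasPointwiseScalingLimit_of_ratio_tendsto`), and the dyadic sequence is a subsequence of the filter.
* `stub_dyadicLimit_of_limitExists` — hence **`(0634 → 4738) → D₂`**: the existence stub of this
  line is implied by (is weaker than, under item 0634) item 4738 — and a fortiori by item 1981
  `ExistsScaleCovariantLimit` (`stub_dyadicLimit_of_existsScaleCovariantLimit`, via the landed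
  `limitExists_of_existsScaleCovariantLimit`) and item 5355 `ExistsRegularLimit`, which imply 4738 outright.
* `stub_dyadicInversion_of_moebiusLimitExists` — **`1344 → I₂`**: the inversion stub is implied by
  item stmt-CriticalPhenomena-1344 `PerfectScreening.MoebiusLimitExists` (through the crux, p122119,
  and `dyadicInversion_of_moebiusLimitOfTwoPointLaw`).

So the exact two-factor residue `crux ↔ D₂ ∧ I₂` (`moebiusLimitOfTwoPointLaw_iff_dyadicLimit_and_dyadicInversion`)
sits between the landed edges `1344 → crux` (p122119) and `crux ↔ (0634 → 4738 ∧ 8367 ∧ 1982)`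
(p117654): `D₂` below 4738, `I₂` below 1344, no `O(3)` factor. No definitions, no `sorry`.
-/

noncomputable section

namespace Summit.CriticalPhenomena.Ising3DConformalLimit.PrecisionLaplacianMoebiusLimitOfTwoPointLaw

open Literature.Probability.LatticeModels Filter Topology EuclideanGeometry
open Summit.CriticalPhenomena.Ising3DConformalLimit.Theses
open Summit.CriticalPhenomena.Ising3DConformalLimit.Theses.PrecisionLaplacian (MoebiusLimitOfTwoPointLaw)
open Summit.CriticalPhenomena.Ising3DConformalLimit.Theorems.MoebiusLimitOfTwoPointLaw.Negative
  (tendsto_canonical_ratio hasPointwiseScalingLimit_of_ratio_tendsto)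

/-- **Bare existence gives the canonical dyadic limits.** Under a witness `(Δ, c)` of the two-point
law, `WeylWindow.LimitExists` (item 4738) yields, for EVERY arity `n`, a locally uniform limit of the
canonically renormalised correlators `2^{knΔ}⟨σ_{[2^k x₁]}⋯σ_{[2^k xₙ]}⟩_{β_c}` on `NonCoincident 3 n`
along `k → ∞` (namely `μⁿ Sₙ` with `μ = lim δ^{-Δ}/ρ(δ) = √(c/S₂(0,e₁))`). -/
theorem dyadicCanonicalLimit_of_limitExists {Δ c : ℝ} (hc : 0 < c)
    (hP : Tendsto (fun x : Site 3 =>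
      criticalTwoPoint 3 x * Real.sqrt (∑ i, ((x i : ℝ)) ^ 2) ^ (2 * Δ)) cofinite (nhds c))
    (hLE : WeylWindow.LimitExists) (n : ℕ) :
    ∃ Tn : (Fin n → EuclideanSpace ℝ (Fin 3)) → ℝ,
      TendstoLocallyUniformlyOn
        (fun k : ℕ => rescaledCorrelator (criticalCorr 3) (fun δ => δ ^ (-Δ)) n (((2:ℝ) ^ k)⁻¹))
        Tn atTop (NonCoincident 3 n) := by
  obtain ⟨ρ, S, hρ, hlim, hnd⟩ := hLE
  have hq := tendsto_canonical_ratio hc hP hρ hlim hnd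
  have hcan := hasPointwiseScalingLimit_of_ratio_tendsto (ρ' := fun δ => δ ^ (-Δ)) hlim
    (fun δ hδ => (hρ δ hδ).ne') hq
  exact ⟨_, tendstoLocallyUniformlyOn_comp_seq (hcan n) tendsto_dyadicMesh⟩

/-- **`(0634 → 4738) → D₂`**: the existence stub `stub_dyadicLimit` of line `SketchIdeator5R2` is
implied by item 4738 `WeylWindow.LimitExists` given item 0634 (`IsingEuclidUpgradeR2RotInvPowerLaw`,
which any witness `(Δ, c)` of the two-point law provides). -/
theorem stub_dyadicLimit_of_limitExists :
    (IsingEuclidUpgrade.IsingEuclidUpgradeR2RotInvPowerLaw → WeylWindow.LimitExists) →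
    ∀ Δ c : ℝ, 0 < c →
      Tendsto (fun x : Site 3 =>
        criticalTwoPoint 3 x * Real.sqrt (∑ i, ((x i : ℝ)) ^ 2) ^ (2 * Δ)) cofinite (nhds c) →
      ∀ n, 4 ≤ n → Even n → ∃ Tn : (Fin n → EuclideanSpace ℝ (Fin 3)) → ℝ,
        TendstoLocallyUniformlyOn
          (fun k : ℕ => rescaledCorrelator (criticalCorr 3) (fun δ => δ ^ (-Δ)) n (((2:ℝ) ^ k)⁻¹))
          Tn atTop (NonCoincident 3 n) := by
  intro h Δ c hc hP n _ _
  exact dyadicCanonicalLimit_of_limitExists hc hP (h ⟨Δ, c, hc, hP⟩) n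

/-- **`1981 → D₂`**: item stmt-CriticalPhenomena-1981 `HyperoctahedralRP.ExistsScaleCovariantLimit` implies
item 4738 outright (`limitExists_of_existsScaleCovariantLimit`, landed), hence the existence stub. -/
theorem stub_dyadicLimit_of_existsScaleCovariantLimit
    (h : HyperoctahedralRP.ExistsScaleCovariantLimit) :
    ∀ Δ c : ℝ, 0 < c →
      Tendsto (fun x : Site 3 =>
        criticalTwoPoint 3 x * Real.sqrt (∑ i, ((x i : ℝ)) ^ 2) ^ (2 * Δ)) cofinite (nhds c) →
      ∀ n, 4 ≤ n → Even n → ∃ Tn : (Fin n → EuclideanSpace ℝ (Fin 3)) → ℝ,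
        TendstoLocallyUniformlyOn
          (fun k : ℕ => rescaledCorrelator (criticalCorr 3) (fun δ => δ ^ (-Δ)) n (((2:ℝ) ^ k)⁻¹))
          Tn atTop (NonCoincident 3 n) :=
  stub_dyadicLimit_of_limitExists fun _ => limitExists_of_existsScaleCovariantLimit h

/-- **`1344 → I₂`**: the inversion stub `stub_dyadicInversion` of line `SketchIdeator5R2` is implied
by item 1344 `PerfectScreening.MoebiusLimitExists` (which gives the crux, p122119; the crux gives `I₂`
by uniqueness of pointwise limits, `dyadicInversion_of_moebiusLimitOfTwoPointLaw`). -/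
theorem stub_dyadicInversion_of_moebiusLimitExists (h : PerfectScreening.MoebiusLimitExists) :
    ∀ Δ c : ℝ, 0 < c →
      Tendsto (fun x : Site 3 =>
        criticalTwoPoint 3 x * Real.sqrt (∑ i, ((x i : ℝ)) ^ 2) ^ (2 * Δ)) cofinite (nhds c) →
      ∀ n, 4 ≤ n → Even n → ∀ Tn : (Fin n → EuclideanSpace ℝ (Fin 3)) → ℝ,
        TendstoLocallyUniformlyOn
          (fun k : ℕ => rescaledCorrelator (criticalCorr 3) (fun δ => δ ^ (-Δ)) n (((2:ℝ) ^ k)⁻¹))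
          Tn atTop (NonCoincident 3 n) →
        ∀ x ∈ NonCoincident 3 n, (∀ i, x i ≠ 0) →
          Tn (fun i => inversion 0 1 (x i)) = (∏ i, ‖x i‖ ^ (2 * Δ)) * Tn x :=
  dyadicInversion_of_moebiusLimitOfTwoPointLaw (moebiusLimitOfTwoPointLaw_of_moebiusLimitExists h)

/-- **`(0634 → 4738) → I₂ → crux`**: with the existence stub discharged by item 4738, the line's
composition needs only the inversion stub `I₂` — the dyadic, rotation-free form of the inversion
upgrade (compare item 1982 `InversionUpgradeNormalised`, which assumes a full-filter Euclidean
scale-covariant limit). -/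
theorem moebiusLimitOfTwoPointLaw_of_limitExists_of_dyadicInversion
    (hLE : IsingEuclidUpgrade.IsingEuclidUpgradeR2RotInvPowerLaw → WeylWindow.LimitExists)
    (hI : ∀ Δ c : ℝ, 0 < c →
      Tendsto (fun x : Site 3 =>
        criticalTwoPoint 3 x * Real.sqrt (∑ i, ((x i : ℝ)) ^ 2) ^ (2 * Δ)) cofinite (nhds c) →
      ∀ n, 4 ≤ n → Even n → ∀ Tn : (Fin n → EuclideanSpace ℝ (Fin 3)) → ℝ,
        TendstoLocallyUniformlyOn
          (fun k : ℕ => rescaledCorrelator (criticalCorr 3) (fun δ => δ ^ (-Δ)) n (((2:ℝ) ^ k)⁻¹))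
          Tn atTop (NonCoincident 3 n) →
        ∀ x ∈ NonCoincident 3 n, (∀ i, x i ≠ 0) →
          Tn (fun i => inversion 0 1 (x i)) = (∏ i, ‖x i‖ ^ (2 * Δ)) * Tn x) :
    MoebiusLimitOfTwoPointLaw :=
  moebiusLimitOfTwoPointLaw_of_dyadic (stub_dyadicLimit_of_limitExists hLE) hI

end Summit.CriticalPhenomena.Ising3DConformalLimit.PrecisionLaplacianMoebiusLimitOfTwoPointLaw

end
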